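import Summits.QuantumFields.YangMills.Theses.UVClassRigidity

/-!
# Assembly of route `UVClassRigidity` (rung R3 of LADDER-YM, leaf `T3YM3TorusStatement.YM3TorusSU2`; item stmt-QuantumFields-26906)

The route file's kernel-checked deciding theorem `closes` packaged as the proof of the route's `Assembly` item:
`UVRigidity → LimitTrajectoriesUVEquivalent → YM3TorusSU2`.  No summit and no Clay statement is proved here; the rung `YM3TorusSU2` (a RECORD rung)
stays open behind the open cruxes `UVRigidity` (stmt-QuantumFields-26905) and `LimitTrajectoriesUVEquivalent` (stmt-QuantumFields-26904).
Filed by the width seat `ym-line-sfw-p2-w2` gen 16 (route affinity: rung R3).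
-/

namespace Summit.QuantumFields.YangMills.Theorems

open Summit.QuantumFields.YangMills.Theses.UVClassRigidity in
/-- The `Assembly` item of route `UVClassRigidity` holds: it is the route's deciding theorem `closes` read as an implication. Nothing about the mass gap. -/
theorem uvClassRigidity_assembly : Summit.QuantumFields.YangMills.Theses.UVClassRigidity.Assembly :=
  fun hB hA => closes hB hA

end Summit.QuantumFields.YangMills.Theorems
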